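import Mathlib.RingTheory.LocalRing.ResidueField.Basic
import Mathlib.RingTheory.Ideal.Quotient.Operations
import Literature.NumberTheory.Automorphic.CompletedCohomologyHeckeAlgebraGLn
import Literature.NumberTheory.Automorphic.ArithmeticQuotientHeckeLocal
import Literature.NumberTheory.Automorphic.CartanDecompositionGLn
import HarnessLib

/-!
# The big Hecke algebra `𝕋(K^p)` of `GL_n` is commutative: discharge of
`BigHeckeGLn.TameLevel.heckeGenerators_commute`

Topic `NumberTheory/Automorphic`; namespace `Literature.NumberTheory.Automorphic.BigHeckeGLn`.
A theorems-first complement to `CompletedCohomologyHeckeAlgebraGLn` (the big Hecke algebra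
`CompletedCohomologyHeckeAlgebraGLn 𝒰 = 𝕋(K^p)` of an `S`-good level datum `𝒰 : TameLevel n K p`,
the closed subring of `∏_{(r,s,i)} End(H^i(X_{U_r}, ℤ/p^s))` topologically generated by the
spherical Hecke operators `T_{v,i}`, `T_{v,n}⁻¹`, `v ∉ S`; its commutativity was vendored there as
the named fact `TameLevel.heckeGenerators_commute` [GeeNewton2020, §2.1.1], on which `commRing`,
`Localized` (`𝕋(K^p)_𝔪`) and `BigGaloisRepAt` depend).

**Main result.** `TameLevel.heckeGenerators_commute_holds 𝒰 : 𝒰.heckeGenerators_commute` — the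
generators pairwise commute — PROVED, whence the unconditional instance
`CommRing (CompletedCohomologyHeckeAlgebraGLn 𝒰)` (equal to `𝒰.commRing _`).

**Proof.** (1) `heckeEnd U k g` (the transpose of the double-coset operator
`heckeAlgebra.doubleCosetOperator U g` on `Module.Dual k k[G ⧸ U]`) is, under evaluation at the
basis vectors `φ ↦ (c ↦ φ [c])` (`evalSingle`, injective), the double-coset operator
`ArithmeticQuotient.heckeFun k U g k` on functions `G ⧸ U → k` of `ArithmeticQuotientCohomology`
(`evalSingle_heckeEnd`); (2) the levels `U_r` of the tower are unramified
(`ArithmeticQuotient.IsUnramifiedLevel`, i.e. `U_r = U_rᵛ × GL_n(𝒪_v)`) at every `v ∉ S`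
(`isUnramifiedLevel_tower`: `𝒰.ofLocal_mem`, `𝒰.le_glFiniteIntegralLevel`), and the generators are
the operators of `ιᵥ(t_{v,i}(ϖ_v))`, `ιᵥ(t_{v,n}(ϖ_v))⁻¹` (`heckeElement_eq_ofLocal`); (3) hence
(`ArithmeticQuotientHeckeLocal`) two generators commute: at different places because `ιᵥ(G_v)` and
`ι_w(G_w)` commute (`heckeFun_comm_of_orthogonal`), at the same place by Gelfand's trick with the
transpose and the `p`-adic Cartan decomposition (`heckeFun_comm_of_antiInvolution`,
`exists_glTranspose_eq_mul_mul_adicCompletion`; [Bump1997, Thm. 4.6.1]); (4) commuting operators on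
the coefficients give commuting operators on group cohomology (functoriality), at every index
`(r, s, i)`.

Also (small API for the routes): `isMaximal_comap_of_continuous` — the pull-back `x⁻¹(𝔪_A)` of the
maximal ideal along a point `x : 𝕋(K^p) → A` (`A` local with finite residue field, e.g. `𝒪_E`,
finite fields) is a MAXIMAL ideal of `𝕋(K^p)` (so `IsPointOver 𝔪 x` makes sense with `𝔪` maximal,
as `Localized` requires), and `liftToLocalization` — a point over `𝔪` factors through
`𝕋(K^p)_𝔪 = Localization.AtPrime 𝔪` (to which `Localized 𝒰 h 𝔪` is definitionally equal).

## References

* T. Gee, J. Newton, *Patching and the completed homology of locally symmetric spaces*,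
  JIMJ (2020), §2.1.1 ("these operators … pairwise commute") [GeeNewton2020].
* C. Khare, J. Thorne, Amer. J. Math. 139 (2017), §6.2 [KhareThorne2017].
* D. Bump, *Automorphic forms and representations* (1997), Thm. 4.6.1 [Bump1997].
-/

noncomputable section

open scoped NumberField
open IsDedekindDomain CategoryTheory MulAction MonoidAlgebra

namespace Literature.NumberTheory.Automorphic

namespace BigHeckeGLn

/-! ### `heckeEnd` versus `ArithmeticQuotient.heckeFun` -/

section Bridge

variable {n : ℕ} {K : Type} [Field K] [NumberField K] (U : Subgroup (FiniteAdelicGL n K))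
  (k : Type) [CommRing k]

/-- Evaluation of a functional on `k[G ⧸ U]` at the basis vectors: `φ ↦ (c ↦ φ [c])`, the
identification `Module.Dual k k[G ⧸ U] = Fun(G ⧸ U, k)` (`G = GL_n(𝔸_K^∞)`). [folklore] -/
def evalSingle :
    Module.Dual k (MonoidAlgebra k (FiniteAdelicGL n K ⧸ U)) →ₗ[k]
      ((FiniteAdelicGL n K ⧸ U) → k) where
  toFun φ c := φ (single c 1)
  map_add' _ _ := rfl
  map_smul' _ _ := rfl

/-- Unfolding lemma for `evalSingle`. [folklore] -/
@[simp]
theorem evalSingle_apply (φ : Module.Dual k (MonoidAlgebra k (FiniteAdelicGL n K ⧸ U)))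
    (c : FiniteAdelicGL n K ⧸ U) :
    evalSingle U k φ c = φ (single c 1) :=
  rfl

/-- `evalSingle` is injective (a functional on `k[G ⧸ U]` is determined on the basis). [folklore] -/
theorem evalSingle_injective : Function.Injective (evalSingle U k) := by
  intro φ ψ h
  refine MonoidAlgebra.lhom_ext' fun c => LinearMap.ext_ring ?_
  simpa using congr_fun h c

open scoped Classical in
/-- The double-coset operator `T_g ∈ ℋ(G, U)` on basis vectors:
`T_g [cU] = ∑_{d ∈ UgU/U} [c̃ • d]` (`c̃ = (cU).out`), a finite sum for a Hecke pair. [folklore] -/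
theorem doubleCosetOperator_single [IsHeckeTriple (⊤ : Submonoid (FiniteAdelicGL n K)) U U]
    (g : FiniteAdelicGL n K) (c : FiniteAdelicGL n K ⧸ U) :
    ((heckeAlgebra.doubleCosetOperator U g : heckeAlgebra k (FiniteAdelicGL n K) U) :
        Module.End k (MonoidAlgebra k (FiniteAdelicGL n K ⧸ U))) (single c 1) =
      ∑ d ∈ (finite_orbit_quotient U g).toFinset, single (c.out • d) (1 : k) := by
  rw [heckeAlgebra.doubleCosetOperator, heckeAlgebra.coe_ofVector, heckeAlgebra.extend_single,
    one_smul, doubleCosetIndicator, finsum_mem_eq_finite_toFinset_sum _ (finite_orbit_quotient U g),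
    map_sum]
  refine Finset.sum_congr rfl fun d _ => ?_
  rw [Representation.ofMulAction_single]

/-- **`heckeEnd` is the double-coset operator on functions**: under `evalSingle`, the transpose
`heckeEnd U k g` of `T_g` is `ArithmeticQuotient.heckeFun k U g k`,
`(T f)(xU) = ∑_{hU ⊆ UgU} f(x h U)` ([GeeNewton2020, §2.1.1] / [KhareThorne2017, §6.2]: the same
operator in the two models of `Fun(GL_n(𝔸^∞)/U, k)`). [folklore] -/
theorem evalSingle_heckeEnd [IsHeckeTriple (⊤ : Submonoid (FiniteAdelicGL n K)) U U]
    (g : FiniteAdelicGL n K) (φ : Module.Dual k (MonoidAlgebra k (FiniteAdelicGL n K ⧸ U))) :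
    evalSingle U k (heckeEnd U k g φ) = ArithmeticQuotient.heckeFun k U g k (evalSingle U k φ) := by
  classical
  funext c
  have hfin : (ArithmeticQuotient.doubleCosetQuot U g).Finite := finite_orbit_quotient U g
  rw [evalSingle_apply, heckeEnd_apply, LinearMap.comp_apply, doubleCosetOperator_single, map_sum,
    ArithmeticQuotient.heckeFun_apply, dif_pos hfin]
  rfl

/-- Commuting double-coset operators on functions give commuting `heckeEnd`s. [folklore] -/
theorem heckeEnd_comm [IsHeckeTriple (⊤ : Submonoid (FiniteAdelicGL n K)) U U]
    {g g' : FiniteAdelicGL n K}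
    (h : ArithmeticQuotient.heckeFun k U g k ∘ₗ ArithmeticQuotient.heckeFun k U g' k =
      ArithmeticQuotient.heckeFun k U g' k ∘ₗ ArithmeticQuotient.heckeFun k U g k) :
    heckeEnd U k g * heckeEnd U k g' = heckeEnd U k g' * heckeEnd U k g := by
  refine LinearMap.ext fun φ => evalSingle_injective U k ?_
  rw [Module.End.mul_apply, Module.End.mul_apply, evalSingle_heckeEnd, evalSingle_heckeEnd,
    evalSingle_heckeEnd, evalSingle_heckeEnd, ← LinearMap.comp_apply, h, LinearMap.comp_apply]

end Bridge

/-! ### Commuting operators on `H^i(X_U, k)` -/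

section Cohomology

variable {n : ℕ} {K : Type} [Field K] [NumberField K] (U : Subgroup (FiniteAdelicGL n K))
  (k : Type) [CommRing k] [IsHeckeTriple (⊤ : Submonoid (FiniteAdelicGL n K)) U U]

/-- Commuting `heckeEnd`s give commuting Hecke operators on `H^i(X_U, k)` (functoriality of group
cohomology). [folklore] -/
theorem heckeOnCohomology_comm {g g' : FiniteAdelicGL n K}
    (h : heckeEnd U k g * heckeEnd U k g' = heckeEnd U k g' * heckeEnd U k g) (i : ℕ) :
    heckeOnCohomology U k g i * heckeOnCohomology U k g' i =
      heckeOnCohomology U k g' i * heckeOnCohomology U k g i := by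
  have hrep : Rep.ofHom (heckeIntertwining U k g') ≫ Rep.ofHom (heckeIntertwining U k g) =
      Rep.ofHom (heckeIntertwining U k g) ≫ Rep.ofHom (heckeIntertwining U k g') :=
    Rep.hom_ext (Representation.IntertwiningMap.ext h)
  have := congrArg (fun f => ((groupCohomology.functor k (GL (Fin n) K) i).map f).hom) hrep
  simp only [Functor.map_comp, ModuleCat.hom_comp] at this
  exact this

end Cohomology

/-! ### The finite-adelic place structure: components, local embeddings -/

section Place

variable {n : ℕ} {K : Type} [Field K] [NumberField K] {v : HeightOneSpectrum (𝓞 K)}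

/-- Entries of `localComponent v x` are the `v`-components of the entries of `x`. [folklore] -/
theorem coe_localComponent_apply (x : FiniteAdelicGL n K) (i j : Fin n) :
    (localComponent n K v x : Matrix (Fin n) (Fin n) (v.adicCompletion K)) i j =
      ((x : Matrix (Fin n) (Fin n) (FiniteAdeleRing (𝓞 K) K)) i j) v :=
  rfl

/-- `localComponent v` of the finite part of an adelic matrix is the adelic `toLocal v`.
[folklore] -/
theorem localComponent_sndHom (x : GL (Fin n) (NumberField.AdeleRing (𝓞 K) K)) :
    localComponent n K v (GLn.sndHom n K x) = (AdelicGroupData.gl n K).toLocal v x :=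
  Matrix.GeneralLinearGroup.ext fun _ _ => rfl

/-- `(ιᵥ g)_v = g`. [folklore] -/
@[simp]
theorem localComponent_ofLocal (g : GL (Fin n) (v.adicCompletion K)) :
    localComponent n K v (ofLocal n K v g) = g := by
  rw [ofLocal, MonoidHom.comp_apply, localComponent_sndHom]
  exact GLn.toLocal_ofLocal g

/-- `(ιᵥ g)_w = 1` for `w ≠ v`. [folklore] -/
theorem localComponent_ofLocal_of_ne {w : HeightOneSpectrum (𝓞 K)} (h : w ≠ v)
    (g : GL (Fin n) (v.adicCompletion K)) : localComponent n K w (ofLocal n K v g) = 1 := by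
  rw [ofLocal, MonoidHom.comp_apply, localComponent_sndHom]
  exact GLn.toLocal_ofLocal_of_ne h g

/-- An element of `GL_n(𝔸_K^∞)` is determined by its local components. [folklore] -/
theorem ext_localComponent {x y : FiniteAdelicGL n K}
    (h : ∀ w : HeightOneSpectrum (𝓞 K), localComponent n K w x = localComponent n K w y) :
    x = y := by
  refine Matrix.GeneralLinearGroup.ext fun i j => RestrictedProduct.ext _ _ fun w => ?_
  have := (Matrix.GeneralLinearGroup.ext_iff _ _).mp (h w) i j
  rwa [coe_localComponent_apply, coe_localComponent_apply] at this

/-- **Elements with trivial `v`-component commute with `ιᵥ(GL_n(K_v))`.** [folklore] -/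
theorem mul_ofLocal_comm {x : FiniteAdelicGL n K} (hx : localComponent n K v x = 1)
    (g : GL (Fin n) (v.adicCompletion K)) : x * ofLocal n K v g = ofLocal n K v g * x := by
  refine ext_localComponent fun w => ?_
  rw [map_mul, map_mul]
  by_cases hw : w = v
  · subst hw
    rw [hx, localComponent_ofLocal, one_mul, mul_one]
  · rw [localComponent_ofLocal_of_ne hw, one_mul, mul_one]

/-- A level `U ≤ GL_n(𝔸_K^∞)` with `ιᵥ(GL_n(𝒪_v)) ≤ U ≤ (·)_v⁻¹ GL_n(𝒪_v)` is unramified at `v`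
in the sense of `ArithmeticQuotient.IsUnramifiedLevel` (the two structural conditions hold in the
restricted product). [folklore] -/
theorem isUnramifiedLevel_of_le {U : Subgroup (FiniteAdelicGL n K)}
    (h₁ : (valuedCongruenceSubgroup (Fin n) (1 : WithZero (Multiplicative ℤ))).map (ofLocal n K v) ≤
      U)
    (h₂ : U ≤ (valuedCongruenceSubgroup (Fin n) (1 : WithZero (Multiplicative ℤ))).comap
      (localComponent n K v)) :
    ArithmeticQuotient.IsUnramifiedLevel (valuedCongruenceSubgroup (Fin n)
      (1 : WithZero (Multiplicative ℤ))) (ofLocal n K v) (localComponent n K v) U where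
  apply_apply := localComponent_ofLocal
  comm_of_apply_eq_one _ hx := mul_ofLocal_comm hx
  map_le := h₁
  le_comap := h₂

/-- **The Hecke element is local**: `t_{v,i} = ιᵥ(diag(ϖ_v,…,ϖ_v,1,…,1))` (`i` entries `ϖ_v`)
(compare `heckeDiagAt_eq_ofLocal_glDiagonal` of `UnramifiedHeckeScalars`). [folklore] -/
theorem heckeElement_eq_ofLocal (v : HeightOneSpectrum (𝓞 K)) (i : ℕ) :
    heckeElement n K v i = ofLocal n K v
      (glDiagonal n (v.adicCompletion K) fun l => if l.val < i then uniformizerAt v else 1) := by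
  refine ext_localComponent fun w => Matrix.GeneralLinearGroup.ext fun a b => ?_
  by_cases hw : w = v
  · subst hw
    rw [localComponent_ofLocal, coe_localComponent_apply, heckeElement, coe_glDiagonal,
      coe_glDiagonal, Matrix.diagonal_apply, Matrix.diagonal_apply]
    split_ifs with hab hi
    · exact uniformizerIdele_apply_self K w _
    · rfl
    · rfl
  · rw [localComponent_ofLocal_of_ne hw, coe_localComponent_apply, heckeElement, coe_glDiagonal,
      Matrix.diagonal_apply, Units.val_one, Matrix.one_apply]
    split_ifs with hab hi
    · exact uniformizerIdele_apply_of_ne K v _ hw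
    · rfl
    · rfl

end Place

/-! ### The tower is unramified outside `S`; the generators commute -/

namespace TameLevel

variable {n : ℕ} {K : Type} [Field K] [NumberField K] {p : ℕ} [Fact p.Prime]
  (𝒰 : TameLevel n K p)

/-- **Every level `U_r` of the tower is unramified at every `v ∉ S`**: it contains `ιᵥ(GL_n(𝒪_v))`
(`𝒰.ofLocal_mem`, and `(ιᵥ g)_w = 1` at the places `w ∣ p`, all in `S`) and its `v`-components are
integral (`U_r ≤ U ≤ GL_n(𝒪̂_K)`). [cite: KhareThorne2017, §6.1] -/
theorem isUnramifiedLevel_tower (r : ℕ) {v : HeightOneSpectrum (𝓞 K)} (hv : v ∉ 𝒰.bad) :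
    ArithmeticQuotient.IsUnramifiedLevel (valuedCongruenceSubgroup (Fin n)
      (1 : WithZero (Multiplicative ℤ))) (ofLocal n K v) (localComponent n K v) (𝒰.tower r) := by
  refine isUnramifiedLevel_of_le ?_ fun u hu =>
    localComponent_mem_valuedCongruenceSubgroup_one (𝒰.le_glFiniteIntegralLevel (𝒰.tower_le r hu)) v
  rintro _ ⟨g, hg, rfl⟩
  change ofLocal n K v g ∈ 𝒰.subgroup ⊓ _
  refine Subgroup.mem_inf.2 ⟨𝒰.ofLocal_mem v hv g hg, Subgroup.mem_iInf.2 fun w => ?_⟩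
  have hwv : (w.1 : HeightOneSpectrum (𝓞 K)) ≠ v := by
    rintro rfl
    exact hv (𝒰.mem_bad_of_mem _ w.2)
  rw [Subgroup.mem_comap, localComponent_ofLocal_of_ne hwv g]
  exact one_mem _

/-- Every generator of `𝕋^S` acting on the tower is the operator of an element `ιᵥ(x)`,
`x ∈ GL_n(K_v)`, at a good place `v ∉ S`. [folklore] -/
theorem exists_eq_heckeOperator_ofLocal {a : 𝒰.bigEnd} (ha : a ∈ 𝒰.heckeGenerators) :
    ∃ v ∉ 𝒰.bad, ∃ x : GL (Fin n) (v.adicCompletion K), a = 𝒰.heckeOperator (ofLocal n K v x) := by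
  rcases ha with ⟨v, hv, i, rfl⟩ | ⟨v, hv, rfl⟩
  · exact ⟨v, hv, _, by rw [heckeElement_eq_ofLocal]⟩
  · exact ⟨v, hv, _, by rw [heckeElement_eq_ofLocal, ← map_inv]⟩

/-- **The operators of `ιᵥ(x)` and `ι_w(y)` (`v, w ∉ S`) commute on every level of the tower with
every coefficient ring** — different places: `heckeFun_comm_of_orthogonal`; the same place:
Gelfand's trick `heckeFun_comm_of_antiInvolution` (transpose + Cartan decomposition).
[cite: GeeNewton2020, §2.1.1] -/
theorem heckeEnd_ofLocal_comm (r : ℕ) (k : Type) [CommRing k] {v w : HeightOneSpectrum (𝓞 K)}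
    (hv : v ∉ 𝒰.bad) (hw : w ∉ 𝒰.bad) (x : GL (Fin n) (v.adicCompletion K))
    (y : GL (Fin n) (w.adicCompletion K)) :
    heckeEnd (𝒰.tower r) k (ofLocal n K v x) * heckeEnd (𝒰.tower r) k (ofLocal n K w y) =
      heckeEnd (𝒰.tower r) k (ofLocal n K w y) * heckeEnd (𝒰.tower r) k (ofLocal n K v x) := by
  refine heckeEnd_comm (𝒰.tower r) k ?_
  by_cases hvw : v = w
  · subst hvw
    exact ArithmeticQuotient.heckeFun_comm_of_antiInvolution k k (𝒰.isUnramifiedLevel_tower r hv)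
      (glTranspose (Fin n)) (fun κ hκ => glTranspose_mem_valuedCongruenceSubgroup hκ)
      glTranspose_glTranspose (exists_glTranspose_eq_mul_mul_adicCompletion v (Fin n)) x y
  · exact ArithmeticQuotient.heckeFun_comm_of_orthogonal k k (𝒰.isUnramifiedLevel_tower r hv)
      (𝒰.isUnramifiedLevel_tower r hw) (fun g => localComponent_ofLocal_of_ne (Ne.symm hvw) g) x y

/-- **Discharge of the named fact `heckeGenerators_commute`: the spherical Hecke operators
`T_{v,i}`, `T_{v,n}⁻¹` (`v ∉ S`) pairwise commute on every `H^i(X_{U_r}, ℤ/p^s)`**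
([GeeNewton2020, §2.1.1]; the local spherical Hecke algebras are commutative and different places
commute). [cite: GeeNewton2020, §2.1.1] -/
theorem heckeGenerators_commute_holds : 𝒰.heckeGenerators_commute := by
  intro a ha b hb
  obtain ⟨v, hv, x, rfl⟩ := 𝒰.exists_eq_heckeOperator_ofLocal ha
  obtain ⟨w, hw, y, rfl⟩ := 𝒰.exists_eq_heckeOperator_ofLocal hb
  funext idx
  exact heckeOnCohomology_comm (𝒰.tower idx.1) (ZMod (p ^ idx.2.1))
    (𝒰.heckeEnd_ofLocal_comm idx.1 (ZMod (p ^ idx.2.1)) hv hw x y) idx.2.2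

/-- **`𝕋(K^p)` is a commutative ring** (unconditionally: `commRing` of
`CompletedCohomologyHeckeAlgebraGLn` fed with `heckeGenerators_commute_holds`; same operations as
the `Ring` instance). [cite: GeeNewton2020, §2.1.1] -/
instance instCommRing : CommRing (CompletedCohomologyHeckeAlgebraGLn 𝒰) :=
  𝒰.commRing 𝒰.heckeGenerators_commute_holds

/-! ### Points: maximality of `x⁻¹(𝔪_A)` and the factorisation through `𝕋(K^p)_𝔪` -/

/-- **The pull-back of the maximal ideal along a point is maximal** when the residue field of the
local ring `A` is finite (`A = 𝒪_E`, a finite field): `𝕋(K^p)/x⁻¹(𝔪_A)` embeds in the finite field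
`A/𝔪_A`, so is a finite domain, hence a field.  Thus `IsPointOver 𝔪 x` only occurs for maximal
`𝔪 = x⁻¹(𝔪_A)`, as `Localized` requires. [folklore] -/
theorem isMaximal_comap_maximalIdeal {A : Type*} [CommRing A] [IsLocalRing A]
    [Finite (IsLocalRing.ResidueField A)] (x : CompletedCohomologyHeckeAlgebraGLn 𝒰 →+* A) :
    (Ideal.comap x (IsLocalRing.maximalIdeal A)).IsMaximal := by
  let g : CompletedCohomologyHeckeAlgebraGLn 𝒰 →+* IsLocalRing.ResidueField A :=
    (IsLocalRing.residue A).comp x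
  have hker : RingHom.ker g = Ideal.comap x (IsLocalRing.maximalIdeal A) := by
    rw [← RingHom.comap_ker, IsLocalRing.ker_residue]
  have hfield : IsField (CompletedCohomologyHeckeAlgebraGLn 𝒰 ⧸ RingHom.ker g) := by
    haveI : Finite g.range := Subtype.finite
    exact MulEquiv.isField (Finite.isField_of_domain g.range)
      (RingHom.quotientKerEquivRange g).toMulEquiv
  rw [← hker]
  exact Ideal.Quotient.maximal_of_isField _ hfield

/-- A point `x` over `𝔪` sends the complement of `𝔪` to units of the local ring `A`. [folklore] -/
theorem isUnit_apply_of_isPointOver {𝔪 : Ideal (CompletedCohomologyHeckeAlgebraGLn 𝒰)} [𝔪.IsPrime]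
    {A : Type*} [CommRing A] [TopologicalSpace A] [IsLocalRing A]
    {x : CompletedCohomologyHeckeAlgebraGLn 𝒰 →+* A} (hx : 𝒰.IsPointOver 𝔪 x)
    (y : 𝔪.primeCompl) : IsUnit (x y.1) := by
  have hy : x y.1 ∉ IsLocalRing.maximalIdeal A := by
    intro h
    have hmem : y.1 ∈ Ideal.comap x (IsLocalRing.maximalIdeal A) := Ideal.mem_comap.2 h
    rw [hx.2] at hmem
    exact y.2 hmem
  simpa [IsLocalRing.mem_maximalIdeal, mem_nonunits_iff] using hy

/-- **A point of `Spf 𝕋(K^p)_𝔪` factors through `𝕋(K^p)_𝔪`**: the ring homomorphism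
`𝕋(K^p)_𝔪 → A` extending a point `x` over a prime `𝔪` (universal property of the localisation;
here `𝕋(K^p)_𝔪 = Localization.AtPrime 𝔪` for the unconditional `CommRing` instance, to which
`Localized 𝒰 h 𝔪` is definitionally equal). [folklore] -/
def liftToLocalization {𝔪 : Ideal (CompletedCohomologyHeckeAlgebraGLn 𝒰)} [𝔪.IsPrime]
    {A : Type*} [CommRing A] [TopologicalSpace A] [IsLocalRing A]
    {x : CompletedCohomologyHeckeAlgebraGLn 𝒰 →+* A} (hx : 𝒰.IsPointOver 𝔪 x) :
    Localization.AtPrime 𝔪 →+* A :=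
  IsLocalization.lift (M := 𝔪.primeCompl) (S := Localization.AtPrime 𝔪) (g := x)
    fun y => 𝒰.isUnit_apply_of_isPointOver hx y

/-- The factorisation extends `x`: `lift (t/1) = x t`. [folklore] -/
@[simp]
theorem liftToLocalization_algebraMap {𝔪 : Ideal (CompletedCohomologyHeckeAlgebraGLn 𝒰)}
    [𝔪.IsPrime] {A : Type*} [CommRing A] [TopologicalSpace A] [IsLocalRing A]
    {x : CompletedCohomologyHeckeAlgebraGLn 𝒰 →+* A} (hx : 𝒰.IsPointOver 𝔪 x)
    (t : CompletedCohomologyHeckeAlgebraGLn 𝒰) :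
    𝒰.liftToLocalization hx (algebraMap _ (Localization.AtPrime 𝔪) t) = x t :=
  IsLocalization.lift_eq (M := 𝔪.primeCompl) (S := Localization.AtPrime 𝔪) _ t

end TameLevel

end BigHeckeGLn

end Literature.NumberTheory.Automorphic
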